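import Summits.KontsevichZagierPeriods.KontsevichZagierPeriods.Theorems.TerasomaMultiplicationBetaCancellationStubWeightConst
import Summits.KontsevichZagierPeriods.KontsevichZagierPeriods.Theorems.TerasomaMultiplicationBetaCancellationStubWeightSemialgebraic

/-!
# `BetaCancellation` (stmt-KontsevichZagierPeriods-13633) — line `dirichlet-companion-to-pi`, stub `stub_weight2Const`

Helper file of the crux lead (`--supports` stmt-KontsevichZagierPeriods-13633), registered stub
`stub_weight2Const` of the skeleton of the line `dirichlet-companion-to-pi` (π-cancellation for
certificates compatible with a weight of BOTH disc coordinates). The showcase two-coordinate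
weight is `h₂ (x, y) = w₁ (x) + w₁ (y)` with `w₁ (u) = (1 + u)√(1 - u²)` (Mathlib's `√` vanishes
on negatives). We prove:

* `h₂` is `ℚ`-semialgebraic on `ℝ²` (each summand is a polynomial times the square root of a
  polynomial; sums, products and square roots of real semialgebraic functions are semialgebraic,
  Bochnak–Coste–Roy Prop. 2.2.6) and `|h₂| ≤ 4` (`|w₁| ≤ 2`, `weightSemialgebraic_abs_le`);
* the weighted closed unit disc `D_h = [{x² + y² ≤ 1}, h₂]` is worth the rational constant
  `16/3 = 8/3 + 8/3` against every factor `s = [σ, f]`: `s × D_h ∼ [σ, (16/3)·f]`.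

The finishing computation is three moves on top of `stub_weightConst`
(`Theorems/TerasomaMultiplicationBetaCancellationStubWeightConst.lean`: the one-coordinate
weighted disc `D_w = [D, w₁ (x)]` is worth `8/3`):

* integrand additivity (rule (1b)): `s × D_h = s × D_w + s × D_w'` with `D_w' = [D, w₁ (y)]`
  (`f ⊗ (w₁ (x) + w₁ (y)) = f ⊗ w₁ (x) + f ⊗ w₁ (y)`);
* the coordinate swap (one rule-(2) move, `KZ.of_sub_of_reindex_mem_relations`):
  `D_w' = D_w.reindex (swap 0 1) ∼ D_w` (the disc is swap-invariant), transported to the products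
  with `s` by `KZ.Equivalent.prod`;
* `stub_weightConst` twice and integrand additivity `[σ, (16/3)·f] = [σ, (8/3)·f] + [σ, (8/3)·f]`.

No definitions are introduced (anonymous constructors and `IntegralRep.reindex`).

References: M. Kontsevich, D. Zagier, *Periods* (2001), §1.1 (eq. (1)), §1.2 (rules (1)–(3));
J. Bochnak, M. Coste, M.-F. Roy, *Real Algebraic Geometry* (1998), Prop. 2.2.6.
-/

noncomputable section

-- `Summit.KontsevichZagierPeriods.KontsevichZagierPeriods.…` is the tree's mandated layout (single-conjunct summit).
set_option linter.dupNamespace false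

namespace Summit.KontsevichZagierPeriods.KontsevichZagierPeriods.BetaCancellationLine

open Set MeasureTheory
open Literature.NumberTheory.Transcendental
open Literature.NumberTheory.Transcendental.KZ
open Literature.ModelTheory.ExponentialFields (IsSemialgebraic isSemialgebraic_univ)
open MvPolynomial (aeval X C)

/-! ## The two-coordinate weight `h₂ (x, y) = w₁ (x) + w₁ (y)` -/

-- adapted from Summits/KontsevichZagierPeriods/KontsevichZagierPeriods/Theorems/TerasomaMultiplicationBetaCancellationStubWeightConst.lean
-- (`weightConst_isSemialgebraicFunOn_weight`: polynomial atoms by `isSemialgebraicFunOn_aeval`,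
-- then `sqrt_holds`, `mul_holds`, `congr`)

/-- Each summand `(x, y) ↦ (1 + zᵢ)√(1 - zᵢ²)` of the two-coordinate weight is `ℚ`-semialgebraic
on `ℝ²` (a polynomial times the square root of a polynomial; Tarski–Seidenberg). [folklore] -/
theorem weight2Const_isSemialgebraicFunOn_summand (i : Fin 2) :
    IsSemialgebraicFunOn ℚ (Set.univ : Set (Fin 2 → ℝ))
      (fun x => (1 + x i) * Real.sqrt (1 - x i ^ 2)) :=
  (IsSemialgebraicFunOn.mul_holds
    (isSemialgebraicFunOn_aeval (isSemialgebraic_univ (k := ℚ) (ι := Fin 2))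
      (1 + X i : MvPolynomial (Fin 2) ℚ))
    (IsSemialgebraicFunOn.sqrt_holds (isSemialgebraicFunOn_aeval
      (isSemialgebraic_univ (k := ℚ) (ι := Fin 2)) (1 - X i ^ 2 : MvPolynomial (Fin 2) ℚ)))).congr
    fun x _ => by simp

/-- The two-coordinate weight `h₂ (x, y) = (1 + x)√(1 - x²) + (1 + y)√(1 - y²)` is
`ℚ`-semialgebraic on `ℝ²` (a sum of two real semialgebraic functions, Bochnak–Coste–Roy
Prop. 2.2.6). [folklore] -/
theorem weight2Const_isSemialgebraicFunOn :
    IsSemialgebraicFunOn ℚ (Set.univ : Set (Fin 2 → ℝ))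
      (fun x => (1 + x 0) * Real.sqrt (1 - x 0 ^ 2) + (1 + x 1) * Real.sqrt (1 - x 1 ^ 2)) :=
  (IsSemialgebraicFunOn.add_holds (weight2Const_isSemialgebraicFunOn_summand 0)
    (weight2Const_isSemialgebraicFunOn_summand 1)).congr fun x _ => by simp [Pi.add_apply]

/-- The two-coordinate weight is bounded by `4 = 2 + 2` (`|w₁| ≤ 2`). [folklore] -/
theorem weight2Const_abs_le (u v : ℝ) :
    |(1 + u) * Real.sqrt (1 - u ^ 2) + (1 + v) * Real.sqrt (1 - v ^ 2)| ≤ 4 := by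
  have hu := weightSemialgebraic_abs_le u
  have hv := weightSemialgebraic_abs_le v
  have h := abs_add_le ((1 + u) * Real.sqrt (1 - u ^ 2)) ((1 + v) * Real.sqrt (1 - v ^ 2))
  linarith

/-! ## The weighted disc `D_h = [D, h₂]` -/

/-- The two-coordinate weight is `ℚ`-semialgebraic on the closed unit disc (restriction from
`ℝ²`). [folklore] -/
theorem weight2Const_isSemialgebraicFunOn_piDisc :
    IsSemialgebraicFunOn ℚ piDisc
      (fun z : Fin 2 → ℝ =>
        (1 + z 0) * Real.sqrt (1 - z 0 ^ 2) + (1 + z 1) * Real.sqrt (1 - z 1 ^ 2)) :=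
  weight2Const_isSemialgebraicFunOn.mono (subset_univ _) isSemialgebraic_piDisc

/-- The two-coordinate weight is absolutely integrable on the closed unit disc (continuous on a
compact set). [folklore] -/
theorem weight2Const_integrableOn_piDisc :
    IntegrableOn (fun z : Fin 2 → ℝ =>
      (1 + z 0) * Real.sqrt (1 - z 0 ^ 2) + (1 + z 1) * Real.sqrt (1 - z 1 ^ 2)) piDisc :=
  (Continuous.continuousOn (by fun_prop)).integrableOn_compact weightConst_isCompact_piDisc

/-! ## Move 1: integrand additivity `s × D_h = s × D_w + s × D_w'` -/

/-- **`s × D_h − s × D_w − s × D_w'` is one integrand-additivity move** (rule (1b)), for any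
representations `Dh = [D, w₁ (x) + w₁ (y)]`, `Dw = [D, w₁ (x)]`, `Dw' = [D, w₁ (y)]` on the disc:
the three products have the common domain `σ × D` and
`f ⊗ (w₁ (x) + w₁ (y)) = f ⊗ w₁ (x) + f ⊗ w₁ (y)` pointwise.
[cite: KontsevichZagier2001, §1.2 rule (1)] -/
theorem weight2Const_of_prod_sub_sub_mem_integrandAddRel {m : ℕ} (s : IntegralRep m)
    (Dh Dw Dw' : IntegralRep 2) (hDhd : Dh.domain = piDisc)
    (hDhi : Dh.integrand = fun z =>
      (1 + z 0) * Real.sqrt (1 - z 0 ^ 2) + (1 + z 1) * Real.sqrt (1 - z 1 ^ 2))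
    (hDwd : Dw.domain = piDisc) (hDwi : Dw.integrand = fun z => (1 + z 0) * Real.sqrt (1 - z 0 ^ 2))
    (hDw'd : Dw'.domain = piDisc)
    (hDw'i : Dw'.integrand = fun z => (1 + z 1) * Real.sqrt (1 - z 1 ^ 2)) :
    of (s.prod Dh) - of (s.prod Dw) - of (s.prod Dw') ∈ integrandAddRel := by
  refine ⟨m + 2, s.prod Dh, s.prod Dw, s.prod Dw', ?_, ?_, fun z _ => ?_, rfl⟩
  · ext z
    simp only [IntegralRep.prod_domain, IntegralRep.mem_prodDomain, hDwd, hDhd]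
  · ext z
    simp only [IntegralRep.prod_domain, IntegralRep.mem_prodDomain, hDw'd, hDhd]
  · simp only [Pi.add_apply, IntegralRep.prod_integrand_eq, IntegralRep.prodFun, hDhi, hDwi, hDw'i]
    ring

/-! ## Move 2: the coordinate swap `D_w' ∼ D_w` -/

/-- **The swapped weighted disc is the reindexed one**: `[D, w₁ (y)] = [D, w₁ (x)].reindex (swap 0 1)`
(the disc `x² + y² ≤ 1` is invariant under the swap). [folklore] -/
theorem weight2Const_eq_reindex_swap (Dw Dw' : IntegralRep 2) (hDwd : Dw.domain = piDisc)
    (hDwi : Dw.integrand = fun z => (1 + z 0) * Real.sqrt (1 - z 0 ^ 2))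
    (hDw'd : Dw'.domain = piDisc)
    (hDw'i : Dw'.integrand = fun z => (1 + z 1) * Real.sqrt (1 - z 1 ^ 2)) :
    Dw' = Dw.reindex (Equiv.swap (0 : Fin 2) 1) := by
  refine IntegralRep.ext' ?_ ?_
  · rw [hDw'd]
    ext z
    simp only [IntegralRep.reindex_domain, hDwd, mem_setOf_eq, mem_piDisc,
      Equiv.swap_apply_left, Equiv.swap_apply_right]
    rw [add_comm]
  · rw [hDw'i]
    funext z
    simp only [IntegralRep.reindex_integrand, hDwi, Equiv.swap_apply_left]

/-- **The coordinate swap is one change-of-variables move**: `s × [D, w₁ (y)] ∼ s × [D, w₁ (x)]`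
(`KZ.of_sub_of_reindex_mem_relations` for `swap 0 1`, transported to the products with `s` by
`KZ.Equivalent.prod`). [cite: KontsevichZagier2001, §1.2 rule (2)] -/
theorem weight2Const_prod_swap_equivalent {m : ℕ} (s : IntegralRep m) (Dw Dw' : IntegralRep 2)
    (hDwd : Dw.domain = piDisc)
    (hDwi : Dw.integrand = fun z => (1 + z 0) * Real.sqrt (1 - z 0 ^ 2))
    (hDw'd : Dw'.domain = piDisc)
    (hDw'i : Dw'.integrand = fun z => (1 + z 1) * Real.sqrt (1 - z 1 ^ 2)) :
    Equivalent (s.prod Dw') (s.prod Dw) := by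
  have hswap : Equivalent Dw Dw' := by
    rw [weight2Const_eq_reindex_swap Dw Dw' hDwd hDwi hDw'd hDw'i]
    exact of_sub_of_reindex_mem_relations Dw (Equiv.swap (0 : Fin 2) 1)
  exact Equivalent.prod (Equivalent.refl s) hswap.symm

/-! ## Move 3: integrand additivity `[σ, (16/3)·f] = [σ, (8/3)·f] + [σ, (8/3)·f]` -/

/-- **`[σ, (16/3)·f] − [σ, (8/3)·f] − [σ, (8/3)·f]` is one integrand-additivity move**
(rule (1b): same domain `σ`, `(16/3) f = (8/3) f + (8/3) f`).
[cite: KontsevichZagier2001, §1.2 rule (1)] -/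
theorem weight2Const_of_constMul_sub_sub_mem_integrandAddRel {m : ℕ} (s : IntegralRep m)
    (ha : IsAlgebraic ℚ (16 / 3 : ℝ)) (ha' : IsAlgebraic ℚ (8 / 3 : ℝ)) :
    of (s.constMul (16 / 3) ha) - of (s.constMul (8 / 3) ha') - of (s.constMul (8 / 3) ha') ∈
      integrandAddRel := by
  refine ⟨m, s.constMul (16 / 3) ha, s.constMul (8 / 3) ha', s.constMul (8 / 3) ha', rfl, rfl,
    fun z _ => ?_, rfl⟩
  simp only [Pi.add_apply, IntegralRep.integrand_constMul]
  ring

/-! ## The finishing equivalence -/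

/-- **`s × D_h ∼ [σ, (16/3)·f]`** for any representations `Dh = [D, w₁ (x) + w₁ (y)]`,
`Dw = [D, w₁ (x)]`, `Dw' = [D, w₁ (y)]` such that `D_w` is worth `8/3` against every factor:
integrand additivity, the coordinate swap, the hypothesis twice, and integrand additivity of the
constants, combined in the group of relations. [folklore] -/
theorem weight2Const_prod_equivalent_constMul {m : ℕ} (s : IntegralRep m)
    (Dh Dw Dw' : IntegralRep 2) (hDhd : Dh.domain = piDisc)
    (hDhi : Dh.integrand = fun z =>
      (1 + z 0) * Real.sqrt (1 - z 0 ^ 2) + (1 + z 1) * Real.sqrt (1 - z 1 ^ 2))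
    (hDwd : Dw.domain = piDisc) (hDwi : Dw.integrand = fun z => (1 + z 0) * Real.sqrt (1 - z 0 ^ 2))
    (hDw'd : Dw'.domain = piDisc)
    (hDw'i : Dw'.integrand = fun z => (1 + z 1) * Real.sqrt (1 - z 1 ^ 2))
    (ha : IsAlgebraic ℚ (16 / 3 : ℝ)) (ha' : IsAlgebraic ℚ (8 / 3 : ℝ))
    (hDwc : Equivalent (s.prod Dw) (s.constMul (8 / 3) ha')) :
    Equivalent (s.prod Dh) (s.constMul (16 / 3) ha) := by
  have h1 : of (s.prod Dh) - of (s.prod Dw) - of (s.prod Dw') ∈ relations :=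
    integrandAddRel_subset_relations (weight2Const_of_prod_sub_sub_mem_integrandAddRel s Dh Dw Dw'
      hDhd hDhi hDwd hDwi hDw'd hDw'i)
  have h2 : of (s.prod Dw) - of (s.constMul (8 / 3) ha') ∈ relations := hDwc
  have h3 : of (s.prod Dw') - of (s.constMul (8 / 3) ha') ∈ relations :=
    (weight2Const_prod_swap_equivalent s Dw Dw' hDwd hDwi hDw'd hDw'i).trans hDwc
  have h4 : of (s.constMul (16 / 3) ha) - of (s.constMul (8 / 3) ha') -
      of (s.constMul (8 / 3) ha') ∈ relations :=
    integrandAddRel_subset_relations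
      (weight2Const_of_constMul_sub_sub_mem_integrandAddRel s ha ha')
  have h := relations.sub_mem (relations.add_mem (relations.add_mem h1 h2) h3) h4
  have e : of (s.prod Dh) - of (s.prod Dw) - of (s.prod Dw') +
      (of (s.prod Dw) - of (s.constMul (8 / 3) ha')) +
      (of (s.prod Dw') - of (s.constMul (8 / 3) ha')) -
      (of (s.constMul (16 / 3) ha) - of (s.constMul (8 / 3) ha') - of (s.constMul (8 / 3) ha')) =
      of (s.prod Dh) - of (s.constMul (16 / 3) ha) := by
    abel
  rw [e] at h
  exact h

/-! ## The stub -/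

/-- **STUB `stub_weight2Const`** (registered stub of the `dirichlet-companion-to-pi` skeleton of
crux `BetaCancellation`; the showcase two-coordinate weight finishes):
`h₂ (x, y) = (1 + x)√(1 − x²) + (1 + y)√(1 − y²)` is `ℚ`-semialgebraic on `ℝ²`, bounded by `4`,
and the weighted disc `[D, h₂]` exists and is worth `16/3` against any factor (integrand
additivity into `[D, w₁ (x)] + [D, w₁ (y)]`, the coordinate swap — one rule-(2) move — onto
`[D, w₁ (x)]`, and `stub_weightConst` twice). [folklore] -/
theorem stub_weight2Const :
    IsSemialgebraicFunOn ℚ (Set.univ : Set (Fin 2 → ℝ))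
      (fun x => (1 + x 0) * Real.sqrt (1 - x 0 ^ 2) + (1 + x 1) * Real.sqrt (1 - x 1 ^ 2)) ∧
    (∀ u v : ℝ, |(1 + u) * Real.sqrt (1 - u ^ 2) + (1 + v) * Real.sqrt (1 - v ^ 2)| ≤ 4) ∧
    ∃ Dh : IntegralRep 2, Dh.domain = piDisc ∧
      (Dh.integrand = fun z => (1 + z 0) * Real.sqrt (1 - z 0 ^ 2) + (1 + z 1) * Real.sqrt (1 - z 1 ^ 2)) ∧
      ∀ (ha : IsAlgebraic ℚ (16 / 3 : ℝ)) (m : ℕ) (s : IntegralRep m),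
        Equivalent (s.prod Dh) (s.constMul (16 / 3) ha) := by
  refine ⟨weight2Const_isSemialgebraicFunOn, weight2Const_abs_le, ?_⟩
  obtain ⟨Dw, hDwd, hDwi, hDwc⟩ := stub_weightConst
  -- `8/3` is algebraic (rational); kept local
  have ha' : IsAlgebraic ℚ (8 / 3 : ℝ) := by
    have h := isAlgebraic_algebraMap (R := ℚ) (A := ℝ) (8 / 3 : ℚ)
    have e : (algebraMap ℚ ℝ) (8 / 3 : ℚ) = (8 / 3 : ℝ) := by
      rw [eq_ratCast]; push_cast; ring
    rwa [e] at h
  let Dh : IntegralRep 2 :=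
    ⟨piDisc, fun z => (1 + z 0) * Real.sqrt (1 - z 0 ^ 2) + (1 + z 1) * Real.sqrt (1 - z 1 ^ 2),
      isSemialgebraic_piDisc, weight2Const_isSemialgebraicFunOn_piDisc,
      weight2Const_integrableOn_piDisc⟩
  let Dw' : IntegralRep 2 := Dw.reindex (Equiv.swap (0 : Fin 2) 1)
  have hDw'd : Dw'.domain = piDisc := by
    ext z
    simp only [Dw', IntegralRep.reindex_domain, hDwd, mem_setOf_eq, mem_piDisc,
      Equiv.swap_apply_left, Equiv.swap_apply_right]
    rw [add_comm]
  have hDw'i : Dw'.integrand = fun z => (1 + z 1) * Real.sqrt (1 - z 1 ^ 2) := by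
    funext z
    simp only [Dw', IntegralRep.reindex_integrand, hDwi, Equiv.swap_apply_left]
  exact ⟨Dh, rfl, rfl, fun ha m s => weight2Const_prod_equivalent_constMul s Dh Dw Dw' rfl rfl
    hDwd hDwi hDw'd hDw'i ha ha' (hDwc ha' m s)⟩

end Summit.KontsevichZagierPeriods.KontsevichZagierPeriods.BetaCancellationLine
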